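import Summits.ResolutionOfSingularities.ResolutionOfSingularities.Theorems.HomologicalConductorNoZenoRGlobalGeneratorsH1
import Summits.ResolutionOfSingularities.ResolutionOfSingularities.Theorems.HomologicalConductorNoZenoBaseIdealBlowupLift
import Literature.AlgebraicGeometry.Resolution.H0InvertibleTimesZeroDimensional
import Literature.AlgebraicGeometry.Resolution.ResolutionDominatedByBlowup
import Literature.AlgebraicGeometry.Resolution.ResolutionFactorsThroughBlowup
import HarnessLib

/-!
# Crux `NoZenoR` (stmt-ResolutionOfSingularities-19943) — Lipman 1969, Proposition (3.1) / statement (*) (p. 203)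
# for desingularizations of a rational surface singularity: `𝔪·𝒪_X` IS INVERTIBLE, hence every
# desingularization DOMINATES THE QUADRATIC TRANSFORM `Bl_𝔪(Spec S)`

Route `ResolutionOfSingularities/HomologicalConductor` (cell decomp-res, hand leafhand-res-homologicalconduct-21 g0).
OURS: AI-written proof over tree theorems, weaker than expert review; nothing here is a statement of the manuscript
under review (Hironaka 2017).  SUPPORT level, counted 0.  Def-free (one private presentation morphism), FACT-FREE
(no named Literature fact is assumed; Lipman (1.2) 2), Görtz–Wedhorn II 24.44 at resolutions and the `h⁰`-calculus are
tree THEOREMS).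

The registered stub `stub_publishedSurfaceFactsW3` of crux `NoZenoR` is, by name, a bundle of six prints, among them
`Lipman1969_4_1` (the minimal desingularization of a normal surface with rational singularities).  Lipman's own proof
of Theorem (4.1) (p. 204) does NOT use the contraction theorem (27.1): it blows up singular points and invokes the
KEY PROPOSITION (*) of §2 / Proposition (3.1) of §3 —

  (*) "If `R` has a rational singularity, and `f : X → Spec(R)` is a desingularization with `X ≠ Spec(R)`, then `X`
      dominates the quadratic transform `V` of `Spec(R)` (i.e. `V` is the surface obtained by blowing up the maximal
      ideal of `R`)";
  (3.1) "Let `R` be a local domain with maximal ideal `𝔪 ≠ (0)`, and let `f : X → Y = Spec(R)` be a proper map, not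
      an isomorphism, with `f_*𝒪_X = 𝒪_Y`, where `X` is a normal surface such that `H¹(X, 𝒪_X) = 0`.  Then the
      `𝒪_X`-ideal `𝓜 = 𝔪𝒪_X` is divisorial.  In particular, if the local rings on `X` are factorial, then `𝔪𝒪_X` is
      invertible, so that `f` factors through the quadratic transform of `Spec(R)`."

Hands 16 g4 / 18 g1 (HAND16G4-REPORT, «LMRB ⟸ Prop. (3.1) [M–L, cohomological, tree Čech kit] + Prop. (8.1) [XL]»)
named (3.1) as the next missing brick of the print-free route to `Lipman1969_4_1`.  THIS FILE PROVES IT for the case the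
chain uses — `X` a desingularization (regular, so its local rings are factorial) of a two-dimensional normal Noetherian
local domain `S` with a rational singularity, `S` not regular:

* (cohomological half, `…Theorems.HomologicalConductorNoZenoRGlobalGeneratorsH1`) `H¹(𝔪𝒪_X) = 0` and
  **`h⁰(𝒪_X/𝔪𝒪_X) ≤ 1`** (`QuadraticTransform.h0_baseIdeal_maximalIdeal_le_one`; Lipman: "`Γ(𝒪_X/𝓜) = R/𝔪`").
* §1 **`isEffectiveCartier_baseIdeal_maximalIdeal`** — **Prop. (3.1) for desingularizations: `𝔪𝒪_X` is an effective
  Cartier divisor.**  Lipman's divisorial argument in the tree's `h⁰`-calculus: `𝔪𝒪_X = 𝓗·𝓚` with `𝓗` invertible and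
  `V(𝓚)` of codimension `2` (`exists_divisorial_decomposition` on the regular `X`; `V(𝓚)` is a finite set of closed
  points, `finite_support_of_one_lt_coheight`), `h⁰(𝒪/𝓗𝓚) = h⁰(𝒪/𝓗) + h⁰(𝒪/𝓚)` (`h0_mul_eq_add_of_finite_support`)
  and `h⁰ ≠ 0` for proper ideal sheaves (`h0_ne_zero_of_ne_top`), so `h⁰ ≤ 1` forces `𝓗 = 𝒪_X` or `𝓚 = 𝒪_X`; the former
  would make the closed fibre `V(𝔪𝒪_X) = V(𝓚)` a finite set of closed points, but it contains an exceptional curve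
  (`IsResolution.excCurvePoints_nonempty`, `S` not regular).  Hence `𝔪𝒪_X = 𝓗` is invertible.
* §2 **`existsUnique_fac_of_isBlowup_maximalIdeal`** / `exists_fac_affineBlowup_maximalIdeal` — **(*) p. 203: the
  desingularization factors uniquely through every blowing up of `Spec S` along `𝔪`, in particular through
  `Bl_𝔪(Spec S) = affineBlowup 𝔪`** (universal property `IsBlowup.universal`, with
  `ExcCount.comap_affineBlowupIdealSheaf_eq_baseIdeal`); **`exists_isResolution_fac_of_isBlowup_maximalIdeal`** — the
  factorisation `σ : X → V` is proper birational, i.e. **`X` is a desingularization of the quadratic transform `V`**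
  (`IsResolution.exists_factor_of_isEffectiveCartier_comap`); `isPrincipal_map_maximalIdeal_toStalk` — the stalkwise
  form `𝔪·𝒪_{X,x}` principal at every `x`; `baseIdeal_maximalIdeal_ne_bot`.

What this buys for the print `Lipman1969_4_1` (HAND16G4-REPORT door 1, «LMRB»): with (3.1) in the tree, Lipman's own
construction of the minimal desingularization of a rational `Spec S` (blow up the closed point, normalise, repeat; every
desingularization dominates each stage by (3.1) applied at the singular points of the stages, which are rational by the
tree theorem `Lipman1969_1_2_holds`) needs, besides termination, only Prop. (8.1) (normality of the quadratic transform of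
a rational singularity — complete ideals, §§5–8; XL) or a finite-normalisation step.  Nothing here proves the crux, the
kill test or the summit; resolution of singularities in positive characteristic is NOT proved by anything here.

References: J. Lipman, Publ. Math. IHÉS 36 (1969): §2 statement (*) and §3 Proposition (3.1) with proof (pp. 203–204),
Theorem (4.1) and its proof (pp. 204–205) [`Lipman1969`]; R. Hartshorne, *Algebraic Geometry* (1977), III Thm. 4.5
(proof, p. 222) [`Hartshorne1977`]; U. Görtz, T. Wedhorn, *Algebraic Geometry I* (2020), Prop. 7.14, Def. 13.90
[`GortzWedhorn2020`]; The Stacks Project, Tags 01WS, 0806 [`StacksProject`].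
-/
noncomputable section

-- single-problem summit: the doubled namespace component `ResolutionOfSingularities` is forced
set_option linter.dupNamespace false

open CategoryTheory CategoryTheory.Limits AlgebraicGeometry TopologicalSpace Opposite IsLocalRing
open Literature.AlgebraicGeometry.Morphisms Literature.AlgebraicGeometry.Modules
open Literature.AlgebraicGeometry.Resolution

namespace Summit.ResolutionOfSingularities.ResolutionOfSingularities.Theorems.NoZeno.QuadraticTransform

universe u

/-! ## §1 Lipman (3.1) for desingularizations: `𝔪𝒪_X` is an effective Cartier divisor -/

section Finite

variable {X : Scheme.{u}}

/-- In a scheme of dimension `≤ n`, a closed subset all of whose points have codimension `≥ n` has dimension `≤ 0`.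
[folklore] -/
-- adapted from the private lemma of `Literature/AlgebraicGeometry/Resolution/Lipman1969StatementBOfPrincipalizationFinite`
private theorem topologicalKrullDim_le_zero_of_le_coheight {n : ℕ} (hdim : topologicalKrullDim X ≤ n)
    {Z : Set X} (hZ : IsClosed Z) (hco : ∀ x ∈ Z, (n : ℕ∞) ≤ Order.coheight x) :
    topologicalKrullDim Z ≤ 0 := by
  have h := topologicalKrullDim_le_of_forall_height_le hZ 0 fun x hx => by
    have h2 : Order.height x + Order.coheight x ≤ n := by
      have := (coe_height_add_coheight_le_topologicalKrullDim x).trans hdim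
      exact_mod_cast this
    have hc : Order.coheight x ≤ n := le_trans le_add_self h2
    obtain ⟨c, hc'⟩ := ENat.ne_top_iff_exists.mp (ne_top_of_le_ne_top (ENat.coe_ne_top n) hc)
    have hh : Order.height x ≠ ⊤ := by
      intro h
      rw [h, top_add, top_le_iff] at h2
      exact ENat.coe_ne_top n h2
    obtain ⟨a, ha'⟩ := ENat.ne_top_iff_exists.mp hh
    have h1 : (n : ℕ∞) ≤ Order.coheight x := hco x hx
    rw [← hc', ← ha'] at h2
    rw [← hc'] at h1
    rw [← ha']
    have h1' : n ≤ c := by exact_mod_cast h1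
    have h2' : a + c ≤ n := by exact_mod_cast h2
    exact_mod_cast (show a ≤ 0 by omega)
  exact_mod_cast h

/-- **On a resolution of the spectrum of a Noetherian domain of dimension `≤ 2`, an ideal sheaf whose cosupport has
codimension `≥ 2` has FINITE cosupport consisting of CLOSED points.** [folklore] -/
-- adapted from the private lemma of `Literature/AlgebraicGeometry/Resolution/Lipman1969StatementBOfPrincipalizationFinite`
theorem finite_support_of_one_lt_coheight {R : Type u} [CommRing R] [IsNoetherianRing R]
    [IsDomain R] (hR : ringKrullDim R ≤ 2) {f : X ⟶ Spec (.of R)} (hf : IsResolution f)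
    (K : X.IdealSheafData) (hco : ∀ x ∈ K.support, 1 < Order.coheight x) :
    (K.support : Set X).Finite ∧ ∀ x ∈ K.support, IsClosed ({x} : Set X) := by
  haveI : IsProper f := hf.isProper
  haveI : IsNoetherian X := by
    haveI : IsLocallyNoetherian X := LocallyOfFiniteType.isLocallyNoetherian f
    haveI : CompactSpace X := QuasiCompact.compactSpace_of_compactSpace f
    exact {}
  have hdimX : topologicalKrullDim X ≤ 2 := by
    refine hf.isBirational.topologicalKrullDim_le_of_isNoetherian.trans ?_
    change topologicalKrullDim (PrimeSpectrum R) ≤ 2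
    rw [PrimeSpectrum.topologicalKrullDim_eq_ringKrullDim]
    exact hR
  have h0 := topologicalKrullDim_le_zero_of_le_coheight (n := 2) hdimX K.support.isClosed fun x hx =>
    Order.add_one_le_of_lt (hco x hx)
  exact ⟨set_finite_of_topologicalKrullDim_le_zero _ h0,
    fun x hx => Literature.Topology.Set.isClosed_singleton_of_topologicalKrullDim_le_zero K.support.isClosed h0 hx⟩

end Finite

section Main

variable {S : Type} [CommRing S] [IsNoetherianRing S] [IsLocalRing S] [IsDomain S] [IsIntegrallyClosed S]
  {X : Scheme.{0}} (π : X ⟶ Spec (.of S))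

omit [IsNoetherianRing S] [IsLocalRing S] [IsDomain S] [IsIntegrallyClosed S] in
/-- **A proper closed subscheme has `h⁰ ≠ 0`**: if `𝓘 ≠ ⊤` then `V(𝓘)` is non-empty, so its ring of global sections is
non-trivial and has positive `S`-length. [folklore] -/
theorem h0_ne_zero_of_ne_top (𝓘 : X.IdealSheafData) (h𝓘 : 𝓘 ≠ ⊤) : h0 π 𝓘 ≠ 0 := by
  -- a point of `V(𝓘)`
  have hne : (𝓘.support : Set X).Nonempty := by
    rw [Set.nonempty_iff_ne_empty]
    intro h
    exact h𝓘 ((Scheme.IdealSheafData.support_eq_bot_iff 𝓘).mp (TopologicalSpace.Closeds.ext h))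
  obtain ⟨x, hx⟩ := hne
  rw [← Scheme.IdealSheafData.range_subschemeι] at hx
  obtain ⟨z, -⟩ := hx
  -- the ring of global sections of the non-empty scheme `V(𝓘)` is non-trivial
  haveI : Nontrivial (Sections (𝓘.subschemeι ≫ π) ⊤) :=
    (𝓘.subscheme.presheaf.germ ⊤ z trivial).hom.domain_nontrivial
  rw [h0_eq]
  exact ne_of_gt Module.length_pos

omit [IsNoetherianRing S] [IsIntegrallyClosed S] in
/-- **`𝔪𝒪_X ≠ 0`** on a desingularization of a two-dimensional local domain: the generic point of `X` lies over the
generic point `(0) ≠ 𝔪` of `Spec S`, outside the closed fibre `V(𝔪𝒪_X)`. [folklore] -/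
theorem baseIdeal_maximalIdeal_ne_bot (hdim : ringKrullDim S = 2) (hπ : IsResolution π) :
    Scheme.IdealSheafData.ofIdealTop ((maximalIdeal S).map (algebraMapΓ π)) ≠ ⊥ := by
  haveI : IsIntegral X := hπ.isIntegral_source
  haveI : IsDominant π := hπ.isBirational.isDominant
  intro hJ
  have hgen : genericPoint X ∈
      ((Scheme.IdealSheafData.ofIdealTop ((maximalIdeal S).map (algebraMapΓ π))).support : Set X) := by
    rw [hJ, Scheme.IdealSheafData.support_bot]
    trivial
  have hsupp : ((Scheme.IdealSheafData.ofIdealTop ((maximalIdeal S).map (algebraMapΓ π))).support : Set X) =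
      π.base ⁻¹' {closedPoint S} := ExcCount.support_baseIdeal_eq π (c := 1) (by rw [pow_one]) le_rfl
  rw [hsupp] at hgen
  have hgen' : π.base (genericPoint X) = closedPoint S := hgen
  have h1 : π.base (genericPoint X) = genericPoint (Spec (.of S)) := genericPoint_eq_of_isDominant π
  rw [h1, genericPoint_eq_bot_of_affine] at hgen'
  have hm : maximalIdeal S = ⊥ := (congrArg PrimeSpectrum.asIdeal hgen').symm
  have h0 := ringKrullDim_eq_zero_of_isField ((IsLocalRing.isField_iff_maximalIdeal_eq).mpr hm)
  rw [hdim] at h0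
  exact absurd h0 (by decide)

/-- **Lipman 1969, Proposition (3.1) / (*) p. 203, for desingularizations of a rational surface singularity.**
Let `S` be a two-dimensional normal Noetherian local domain with a rational singularity which is NOT regular, and
`π : X → Spec S` a desingularization.  Then the ideal sheaf `𝔪𝒪_X` (`ofIdealTop (𝔪·Γ(X, 𝒪_X))`) is an EFFECTIVE
CARTIER DIVISOR (invertible).  Proof (Lipman, pp. 203–204, in the tree's `h⁰`-calculus): write `𝔪𝒪_X = 𝓗·𝓚` with `𝓗`
invertible and `V(𝓚)` finite (divisorial part on the regular surface `X`); then
`h⁰(𝒪/𝔪𝒪_X) = h⁰(𝒪/𝓗) + h⁰(𝒪/𝓚) ≤ 1` (`Γ(𝒪_X/𝔪𝒪_X) = S/𝔪` by `H¹(𝔪𝒪_X) = 0`), so `𝓗 = 𝒪_X` or `𝓚 = 𝒪_X`;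
the former would make the closed fibre `V(𝔪𝒪_X) = V(𝓚)` finite, contradicting the existence of an exceptional curve.
[cite: Lipman1969, Proposition (3.1) (p. 203) and its proof (pp. 203–204)] -/
theorem isEffectiveCartier_baseIdeal_maximalIdeal (hdim : ringKrullDim S = 2) (hrat : HasRationalSingularity S)
    (hsing : ¬ IsRegularLocalRing S) (hπ : IsResolution π) :
    IsEffectiveCartier (Scheme.IdealSheafData.ofIdealTop ((maximalIdeal S).map (algebraMapΓ π))) := by
  set J := Scheme.IdealSheafData.ofIdealTop ((maximalIdeal S).map (algebraMapΓ π)) with hJdef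
  haveI : IsProper π := hπ.isProper
  haveI : IsIntegral X := hπ.isIntegral_source
  haveI : IsDominant π := hπ.isBirational.isDominant
  haveI : IsLocallyNoetherian X := LocallyOfFiniteType.isLocallyNoetherian π
  haveI : CompactSpace X := QuasiCompact.compactSpace_of_compactSpace π
  haveI : IsNoetherian X := {}
  -- the support of `𝔪𝒪_X` is the closed fibre
  have hsupp : (J.support : Set X) = π.base ⁻¹' {closedPoint S} :=
    ExcCount.support_baseIdeal_eq π (c := 1) (by rw [pow_one]) le_rfl
  have hJ0 : J ≠ ⊥ := baseIdeal_maximalIdeal_ne_bot π hdim hπ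
  -- divisorial decomposition `𝔪𝒪_X = 𝓗·𝓚`
  obtain ⟨H, K, hH, hHK, -, -, hco⟩ := exists_divisorial_decomposition hπ.isRegular hJ0
  obtain ⟨hKfin, hKcl⟩ := finite_support_of_one_lt_coheight hdim.le hπ K hco
  have hadd : h0 π J = h0 π H + h0 π K := by
    rw [← hHK]
    exact h0_mul_eq_add_of_finite_support π H K hH hKfin hKcl subset_rfl
  have hle : h0 π J ≤ 1 := h0_baseIdeal_maximalIdeal_le_one π hdim hrat hπ
  by_cases hK : K = ⊤
  · -- `𝓚 = 𝒪_X`: `𝔪𝒪_X = 𝓗` is invertible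
    have hJH : J = H := by
      rw [← hHK, hK, ← Scheme.IdealSheafData.one_eq_top, mul_one]
    rw [hJH]
    exact hH
  · exfalso
    by_cases hHtop : H = ⊤
    · -- `𝓗 = 𝒪_X`: the closed fibre `V(𝔪𝒪_X) = V(𝓚)` would be a finite set of closed points
      have hJK : J = K := by
        rw [← hHK, hHtop, ← Scheme.IdealSheafData.one_eq_top, one_mul]
      obtain ⟨η, hη⟩ := hπ.excCurvePoints_nonempty hdim hsing
      have hηJ : η ∈ (J.support : Set X) := by
        rw [hsupp]
        exact hη.1
      rw [hJK] at hηJ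
      have h0η := Scheme.height_of_isClosed (hKcl η hηJ)
      rw [hη.2] at h0η
      exact one_ne_zero h0η
    · -- both factors proper: `h⁰ ≥ 1 + 1`, contradicting `h⁰(𝒪/𝔪𝒪_X) ≤ 1`
      have h1 : 1 ≤ h0 π H := Order.one_le_iff_ne_zero.mpr (h0_ne_zero_of_ne_top π H hHtop)
      have h2 : 1 ≤ h0 π K := Order.one_le_iff_ne_zero.mpr (h0_ne_zero_of_ne_top π K hK)
      have h12 : (2 : ℕ∞) ≤ h0 π J := by
        rw [hadd, show (2 : ℕ∞) = 1 + 1 from rfl]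
        exact add_le_add h1 h2
      have := h12.trans hle
      exact absurd this (by decide)

end Main

/-! ## §2 (*) p. 203: every desingularization DOMINATES THE QUADRATIC TRANSFORM -/

section Domination

variable {S : Type} [CommRing S] [IsNoetherianRing S] [IsLocalRing S] [IsDomain S] [IsIntegrallyClosed S]
  {X : Scheme.{0}} (π : X ⟶ Spec (.of S))

/-- The inverse image of the centre `𝔪̃` of the quadratic transform is an effective Cartier divisor on every
desingularization of a non-regular rational `Spec S`. [cite: Lipman1969, Proposition (3.1) (p. 203)] -/
theorem isEffectiveCartier_comap_affineBlowupIdealSheaf_maximalIdeal (hdim : ringKrullDim S = 2)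
    (hrat : HasRationalSingularity S) (hsing : ¬ IsRegularLocalRing S) (hπ : IsResolution π) :
    IsEffectiveCartier ((affineBlowup.idealSheaf (maximalIdeal S)).comap π) := by
  rw [ExcCount.comap_affineBlowupIdealSheaf_eq_baseIdeal]
  exact isEffectiveCartier_baseIdeal_maximalIdeal π hdim hrat hsing hπ

/-- **Lipman 1969, (*) p. 203 — "if `R` has a rational singularity, and `f : X → Spec(R)` is a desingularization
with `X ≠ Spec(R)`, then `X` dominates the quadratic transform `V` of `Spec(R)`"**: for `S` a two-dimensional normal
Noetherian local domain with a rational singularity, not regular, every desingularization `π : X → Spec S` factors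
UNIQUELY through every blowing up `b : V → Spec S` of the maximal ideal (`IsBlowup b 𝔪̃`).
[cite: Lipman1969, Section 2, (*) (p. 203) and Proposition (3.1) (p. 203)] -/
theorem existsUnique_fac_of_isBlowup_maximalIdeal (hdim : ringKrullDim S = 2) (hrat : HasRationalSingularity S)
    (hsing : ¬ IsRegularLocalRing S) (hπ : IsResolution π) {V : Scheme.{0}} {b : V ⟶ Spec (.of S)}
    (hb : IsBlowup b (affineBlowup.idealSheaf (maximalIdeal S))) :
    ∃! σ : X ⟶ V, σ ≫ b = π :=
  hb.universal π (isEffectiveCartier_comap_affineBlowupIdealSheaf_maximalIdeal π hdim hrat hsing hπ)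

/-- **The desingularization dominates the quadratic transform `Bl_𝔪(Spec S) = affineBlowup 𝔪`**:
`∃ σ : X ⟶ Bl_𝔪(Spec S)` with `σ ≫ (Bl_𝔪 → Spec S) = π`. [cite: Lipman1969, Section 2, (*) (p. 203)] -/
theorem exists_fac_affineBlowup_maximalIdeal (hdim : ringKrullDim S = 2) (hrat : HasRationalSingularity S)
    (hsing : ¬ IsRegularLocalRing S) (hπ : IsResolution π) :
    ∃ σ : X ⟶ affineBlowup (maximalIdeal S), σ ≫ affineBlowup.π (maximalIdeal S) = π :=
  (existsUnique_fac_of_isBlowup_maximalIdeal π hdim hrat hsing hπ (affineBlowup.isBlowup (maximalIdeal S))).exists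

/-- **`X` is a DESINGULARIZATION OF THE QUADRATIC TRANSFORM**: for every blowing up `b : V → Spec S` of the maximal
ideal, the factorisation `σ : X → V` (`σ ≫ b = π`) is proper and birational, i.e. `σ` is a resolution of `V` — the form
in which Lipman's proof of Theorem (4.1) iterates (*) ("blow up a singular point … continue in this way … (*) shows that
for every desingularization `f′ : X′ → Y`, `X′` dominates `X`", p. 204–205).
[cite: Lipman1969, Section 2, (*) (p. 203); Theorem (4.1), proof (pp. 204–205)] -/
theorem exists_isResolution_fac_of_isBlowup_maximalIdeal (hdim : ringKrullDim S = 2)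
    (hrat : HasRationalSingularity S) (hsing : ¬ IsRegularLocalRing S) (hπ : IsResolution π) {V : Scheme.{0}}
    {b : V ⟶ Spec (.of S)} (hb : IsBlowup b (affineBlowup.idealSheaf (maximalIdeal S))) :
    ∃ σ : X ⟶ V, σ ≫ b = π ∧ IsResolution σ := by
  have hcart := isEffectiveCartier_comap_affineBlowupIdealSheaf_maximalIdeal π hdim hrat hsing hπ
  have hI0 : affineBlowup.idealSheaf (maximalIdeal S) ≠ ⊥ := by
    intro h
    apply baseIdeal_maximalIdeal_ne_bot π hdim hπ
    rw [← ExcCount.comap_affineBlowupIdealSheaf_eq_baseIdeal, h, Scheme.IdealSheafData.comap_bot]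
  obtain ⟨σ, hσ, hprop, hbir⟩ := hπ.exists_factor_of_isEffectiveCartier_comap hI0 hb hcart
  exact ⟨σ, hσ, ⟨hprop, hbir, hπ.isRegular⟩⟩

/-- **At every point of a desingularization of a non-regular rational `Spec S`, `𝔪·𝒪_{X,x}` is principal**
(the stalkwise form of Prop. (3.1): "`𝔪𝒪_X` is invertible"). [cite: Lipman1969, Proposition (3.1) (p. 203)] -/
theorem isPrincipal_map_maximalIdeal_toStalk (hdim : ringKrullDim S = 2) (hrat : HasRationalSingularity S)
    (hsing : ¬ IsRegularLocalRing S) (hπ : IsResolution π) (x : X) :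
    ((maximalIdeal S).map (ExcCount.toStalk π x)).IsPrincipal := by
  rw [← ExcCount.stalkIdeal_baseIdeal_eq_map_toStalk]
  obtain ⟨U, hxU, f, -, hf⟩ := isEffectiveCartier_baseIdeal_maximalIdeal π hdim hrat hsing hπ x
  exact IsLocallyPrincipalAt.isPrincipal_stalkIdeal ⟨U, hxU, f, hf⟩

end Domination

end Summit.ResolutionOfSingularities.ResolutionOfSingularities.Theorems.NoZeno.QuadraticTransform

end
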